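import Literature.NumberTheory.Transcendental.KZVolumeConjectureProofs
import Literature.NumberTheory.Transcendental.KZSemiCanonicalReductionProofs
import HarnessLib

/-!
# Crux `KernelForm` (stmt-KontsevichZagierPeriods-10447), line `Sketch`: stub `stub_boundedDecomposition`

Bookkeeping over the free abelian group `KZ.FormalRep`: every formal `ℤ`-combination `s` of
integral representations is, modulo the moves, a difference `[A] − [B]` of two BOUNDED VOLUME FORMS
(bounded `ℚ`-semialgebraic domain, integrand `1` on it) of ONE common dimension `k + 1`.

Induction on the free abelian group (`FreeAbelianGroup.induction_on`):

* `0 ≡ [∅] − [∅]` with `∅` the empty representation in dimension `1`;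
* a generator `[r]`, `r : IntegralRep n`, is `≡ [A] − [B]` with bounded volumes `A`, `B` of
  dimension `n + 1` (`KZ.exists_sub_isBounded`, Viu-Sos' Cor. 2.3 inside the rules);
* `−([A] − [B]) = [B] − [A]`;
* for a sum, the four bounded volumes are first raised to the common dimension `max k₁ k₂ + 1` by
  unit slabs `A × [0, 1]` (one Newton–Leibniz move each, `KZ.IntegralRep.slab`; slabs of bounded
  sets are bounded), and then merged pairwise (`KZ.exists_merge₂`: disjoint translates glued by
  domain additivity).
-/

noncomputable section

open Set
open Literature.NumberTheory.Transcendental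

namespace Summit.KontsevichZagierPeriods.KernelForm.LocaliseAtValuePrime

/-- The unit slab `σ × [j, j + 1]` over a bounded set `σ ⊆ ℝᵐ` is bounded (sup norm: each of the
first `m` coordinates is bounded by the bound for `σ`, the last one by `j + 1`). [folklore] -/
theorem isBounded_slabDomain {m : ℕ} (r : KZ.IntegralRep m) (j : ℕ)
    (h : Bornology.IsBounded r.domain) : Bornology.IsBounded (r.slabDomain j) := by
  obtain ⟨C, hC⟩ := isBounded_iff_forall_norm_le.mp h
  refine isBounded_iff_forall_norm_le.mpr ⟨max C (j + 1), fun z hz => ?_⟩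
  simp only [KZ.IntegralRep.slabDomain, mem_setOf_eq] at hz
  obtain ⟨hinit, h0, h1⟩ := hz
  refine (pi_norm_le_iff_of_nonneg (le_max_of_le_right (by positivity))).mpr fun i => ?_
  refine Fin.lastCases ?_ (fun i => ?_) i
  · rw [Real.norm_eq_abs]
    refine le_max_of_le_right (abs_le.mpr ⟨?_, h1⟩)
    linarith [(Nat.cast_nonneg j : (0 : ℝ) ≤ j)]
  · calc ‖z (Fin.castSucc i)‖ = ‖Fin.init z i‖ := rfl
      _ ≤ ‖Fin.init z‖ := norm_le_pi_norm _ i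
      _ ≤ C := hC _ hinit
      _ ≤ max C (j + 1) := le_max_left _ _

/-- **Raising the dimension of a bounded volume form.** A representation of dimension `k + 1` with
bounded domain and integrand `1` on it is equivalent, for every `d`, to such a representation of
dimension `k + d + 1`: iterate the unit slab `A × [0, 1]` (one Newton–Leibniz move each,
`KZ.IntegralRep.equivalent_slab`). [folklore] -/
theorem exists_isBounded_lift_add (k : ℕ) :
    ∀ (d : ℕ) (A : KZ.IntegralRep (k + 1)), Bornology.IsBounded A.domain →
      (∀ z ∈ A.domain, A.integrand z = 1) →
      ∃ A' : KZ.IntegralRep (k + d + 1), Bornology.IsBounded A'.domain ∧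
        (∀ z ∈ A'.domain, A'.integrand z = 1) ∧ KZ.of A - KZ.of A' ∈ KZ.relations
  | 0, A, hb, h1 => ⟨A, hb, h1, by simp⟩
  | d + 1, A, hb, h1 => by
    obtain ⟨A', hb', h1', e⟩ := exists_isBounded_lift_add k d A hb h1
    refine ⟨A'.slab 0, isBounded_slabDomain A' 0 hb', A'.slab_integrand_eq_one 0 h1', ?_⟩
    have hs : KZ.of A' - KZ.of (A'.slab 0) ∈ KZ.relations := A'.equivalent_slab 0
    have : KZ.of A - KZ.of (A'.slab 0) = (KZ.of A - KZ.of A') + (KZ.of A' - KZ.of (A'.slab 0)) := by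
      abel
    rw [this]
    exact KZ.relations.add_mem e hs

/-- A bounded volume form of dimension `k + 1` is equivalent to a bounded volume form of any
dimension `N + 1 ≥ k + 1`. [folklore] -/
theorem exists_isBounded_lift_of_le {k N : ℕ} (h : k ≤ N) (A : KZ.IntegralRep (k + 1))
    (hb : Bornology.IsBounded A.domain) (h1 : ∀ z ∈ A.domain, A.integrand z = 1) :
    ∃ A' : KZ.IntegralRep (N + 1), Bornology.IsBounded A'.domain ∧
      (∀ z ∈ A'.domain, A'.integrand z = 1) ∧ KZ.of A - KZ.of A' ∈ KZ.relations := by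
  obtain ⟨d, rfl⟩ := Nat.exists_eq_add_of_le h
  exact exists_isBounded_lift_add k d A hb h1

/-- **Stub `stub_boundedDecomposition`.** Every formal `ℤ`-combination of integral representations
is, modulo the moves, a difference `[A] − [B]` of two bounded volume forms (bounded domain,
integrand `1` on it) of one common dimension `k + 1`. Induction on the free abelian group:
`0 ≡ [∅] − [∅]`; a generator by `KZ.exists_sub_isBounded`; negation swaps `A` and `B`; for sums,
raise the four forms to the common dimension by unit slabs (`exists_isBounded_lift_of_le`) and
merge pairwise (`KZ.exists_merge₂`). [folklore] -/
theorem stub_boundedDecomposition :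
    ∀ s : KZ.FormalRep, ∃ (k : ℕ) (A B : KZ.IntegralRep (k + 1)),
      Bornology.IsBounded A.domain ∧ Bornology.IsBounded B.domain ∧
      (∀ z ∈ A.domain, A.integrand z = 1) ∧ (∀ z ∈ B.domain, B.integrand z = 1) ∧
      s - (KZ.of A - KZ.of B) ∈ KZ.relations := by
  intro s
  induction s using FreeAbelianGroup.induction_on with
  | zero =>
    exact ⟨0, KZ.IntegralRep.empty 1, KZ.IntegralRep.empty 1, by simp, by simp, by simp, by simp,
      by simp⟩
  | of x =>
    obtain ⟨n, r⟩ := x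
    obtain ⟨A, B, hAb, hBb, hA1, hB1, e⟩ := KZ.exists_sub_isBounded r
    exact ⟨n, A, B, hAb, hBb, hA1, hB1, e⟩
  | neg x hx =>
    obtain ⟨k, A, B, hAb, hBb, hA1, hB1, e⟩ := hx
    refine ⟨k, B, A, hBb, hAb, hB1, hA1, ?_⟩
    have : -FreeAbelianGroup.of x - (KZ.of B - KZ.of A) =
        -(FreeAbelianGroup.of x - (KZ.of A - KZ.of B)) := by
      abel
    rw [this]
    exact KZ.relations.neg_mem e
  | add x y hx hy =>
    obtain ⟨k₁, A₁, B₁, hA₁b, hB₁b, hA₁1, hB₁1, e₁⟩ := hx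
    obtain ⟨k₂, A₂, B₂, hA₂b, hB₂b, hA₂1, hB₂1, e₂⟩ := hy
    obtain ⟨A₁', hA₁'b, hA₁'1, eA₁⟩ := exists_isBounded_lift_of_le (le_max_left k₁ k₂) A₁ hA₁b hA₁1
    obtain ⟨B₁', hB₁'b, hB₁'1, eB₁⟩ := exists_isBounded_lift_of_le (le_max_left k₁ k₂) B₁ hB₁b hB₁1
    obtain ⟨A₂', hA₂'b, hA₂'1, eA₂⟩ :=
      exists_isBounded_lift_of_le (le_max_right k₁ k₂) A₂ hA₂b hA₂1
    obtain ⟨B₂', hB₂'b, hB₂'1, eB₂⟩ :=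
      exists_isBounded_lift_of_le (le_max_right k₁ k₂) B₂ hB₂b hB₂1
    obtain ⟨A, hAb, hA1, eA⟩ := KZ.exists_merge₂ A₁' A₂' hA₁'b hA₂'b hA₁'1 hA₂'1
    obtain ⟨B, hBb, hB1, eB⟩ := KZ.exists_merge₂ B₁' B₂' hB₁'b hB₂'b hB₁'1 hB₂'1
    refine ⟨max k₁ k₂, A, B, hAb, hBb, hA1, hB1, ?_⟩
    have : x + y - (KZ.of A - KZ.of B) =
        (x - (KZ.of A₁ - KZ.of B₁)) + (y - (KZ.of A₂ - KZ.of B₂)) +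
          ((KZ.of A₁ - KZ.of A₁') - (KZ.of B₁ - KZ.of B₁')) +
          ((KZ.of A₂ - KZ.of A₂') - (KZ.of B₂ - KZ.of B₂')) +
          (KZ.of A₁' + KZ.of A₂' - KZ.of A) - (KZ.of B₁' + KZ.of B₂' - KZ.of B) := by
      abel
    rw [this]
    exact KZ.relations.sub_mem (KZ.relations.add_mem (KZ.relations.add_mem
      (KZ.relations.add_mem (KZ.relations.add_mem e₁ e₂) (KZ.relations.sub_mem eA₁ eB₁))
      (KZ.relations.sub_mem eA₂ eB₂)) eA) eB

end Summit.KontsevichZagierPeriods.KernelForm.LocaliseAtValuePrime
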